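import Mathlib.RingTheory.MvPowerSeries.Basic
import Mathlib.RingTheory.DedekindDomain.Factorization
import Mathlib.RingTheory.DedekindDomain.Different
import Mathlib.RingTheory.RamificationInertia.Ramification
import Literature.NumberTheory.EllipticCurves.DeShalit1987.KatzPAdicLFunction
import Literature.NumberTheory.GaloisRepresentations.CMTypeHeckeCharacter
import Literature.NumberTheory.GaloisRepresentations.HeckeCharacterConductorExponent
import HarnessLib

/-!
# The Katz–Hida–Tilouine `p`-adic `L`-function of a CM field with a `p`-ordinary CM type, in
# Hsieh's normalisation (Hsieh, J. reine angew. Math. 688 (2014), Prop. 4.9 and §1 display;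
# Katz 1978 Thm. (5.3.0); Hida–Tilouine 1993 Thm. II): the CHARACTERISING PREDICATE of a twisted
# branch along a `ℤ_pⁿ`-quotient, in `n` variables and on a `ℤ_p`-line, and ONE named existence fact

Topic `NumberTheory/EllipticCurves` (namespace = path; sub-namespace `KatzCM` for the object). Companion
of the tree's one- and two-variable Katz-type frames for an IMAGINARY QUADRATIC field
(`DeShalit1987.IsKatzBranch`, `Rubin1991.IsKatzMeasure₂`, `CastellaGrossiLeeSkinner2022.IsKatzLFunction`,
`IsBDPLFunction`, `IsHsiehLFunction`), whose conventions (embedding datum `ι : ℚ̄_p ≃ ℂ`, avatars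
`IsPAdicAvatarOf` / `FactorsThroughZp`, `heckeValueExtZero`, an entire-continuation binder for the
`L`-value, receptacle `𝒪_{ℂ_p}⟦T⟧`, periods existential in the fact) are used VERBATIM; what is new is
the passage from `[L:ℚ] = 2` to a general CM field `L` with a `p`-ordinary CM type. Requested by the
lead prover of crux `EisensteinHeartFlatCMInertBadKPrime` (route `BiquadraticEisensteinDescent` of
`Summits/BirchSwinnertonDyer`, line `hsieh-lambda`, card §"Layer 2": the Katz–Hsieh factorisation on
the `K′`-line of the biquadratic CM field `L = K·K′` and the Shapiro/Fitting specialisation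
`Λ_L^{(3)} → Λ` both need "`IsKatzMeasureCM` … and the branch / `K′`-line restriction"); typed by a
width prover seat of that line. STATEMENTS FIRST (D-0064: one file for Hsieh's §4.7–4.8 with the §1
display): definitions with bodies, small proved API, and exactly ONE named fact
(`hsieh2014mu_prop49_exists_isMeasure`, +1 declared debt); no `sorry`, no `instance`, no notation.
Nothing here is specific to, or asserts anything about, any case of BSD.

## The printed statements (M.-L. Hsieh, *On the μ-invariant of anticyclotomic p-adic L-functions
## for CM fields*, J. reine angew. Math. 688 (2014) 67–100 = arXiv:1112.1574, TeX source held as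
## `paper:arxiv-1112.1574`; locators are SECTION / PROPOSITION numbers of the e-print)

* §1 (Introduction): "Let `p > 2` … `𝓕` totally real of degree `d`, `𝓚` a totally imaginary quadratic
  extension of `𝓕` … (ord) every prime of `𝓕` above `p` splits in `𝓚`. Fix a `p`-ordinary CM type
  `Σ` … complex CM period `Ω_∞ = (Ω_{∞,σ})_σ ∈ (ℂ^×)^Σ` and `p`-adic CM period
  `Ω_p = (Ω_{p,σ})_σ ∈ (Z̄_p^×)^Σ`. Let `ℭ` be a prime-to-`p` integral ideal of `𝓚` and decompose
  `ℭ = ℭ⁺ℭ⁻` [split / non-split part]. Let `Z(ℭ)` be the ray class group of `𝓚` modulo `ℭp^∞`. In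
  [Katz78] and [HT93], a `Z̄_p`-valued measure `𝓛_{ℭ,Σ}` on `Z(ℭ)` is constructed such that
  `(1/Ω_p^{kΣ+2κ}) · ∫_{Z(ℭ)} χ̂ d𝓛_{ℭ,Σ} = L^{(pℭ)}(0, χ) · Eul_p(χ) Eul_{ℭ⁺}(χ) ·
  π^κ Γ_Σ(kΣ+κ) / (√|D_𝓕| (Im ϑ)^κ · Ω_∞^{kΣ+2κ}) · [𝒪_𝓚^× : 𝒪_𝓕^×]`, where (i) `χ` is a Hecke
  character modulo `ℭp^∞` of infinity type `kΣ + κ(1 − c)` with either `k ≥ 1` and `κ ∈ ℤ_{≥0}[Σ]`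
  or `k ≤ 1` and `kΣ + κ ∈ ℤ_{>0}[Σ]`, and `χ̂` is the avatar of `χ` regarded as a Galois character via
  geometrically normalized reciprocity law, (ii) `Eul_p(χ)` and `Eul_{ℭ⁺}(χ)` are certain modified Euler
  factors, (iii) `ϑ` is a well-chosen element in `𝓚` such that `c(ϑ) = −ϑ`." Then: "Let `Γ⁻` be the
  maximal `ℤ_p`-free quotient of the anticyclotomic quotient … `𝓛⁻_{χ,Σ}` the measure on `Γ⁻` obtained
  by the pull-back of `𝓛_{ℭ,Σ}` along `χ`: `∫_{Γ⁻} φ d𝓛⁻_{χ,Σ} = ∫_{Z(ℭ)} φ χ̂ d𝓛_{ℭ,Σ}`."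
* §1.1: "(unr) `2 < p ∤ D_𝓕`"; "`Σ_p = {w ∈ h_𝓚 : w ∣ p` and `w` is induced by `ι_p ∘ σ` for
  `σ ∈ Σ}` … `Σ` is `p`-ordinary if `Σ_p ∩ Σ_p c = ∅` and `Σ_p ∪ Σ_p c` is the set of places of `𝓚`
  lying above `p`"; §1.2: `rec_L` "the geometrically normalized reciprocity law", `ψ_L = ψ_ℚ ∘ Tr_{L/ℚ}`
  with `ψ_ℚ(x_∞) = exp(2πi x_∞)`; §1.3: Haar measures with `vol(𝒪_F) = 1`.
* §3.1: "`𝔇 := pℭℭ^c D_{𝓚/𝓕}`. We choose `ϑ ∈ 𝓚` such that (d1) `ϑ^c = −ϑ` and `Im σ(ϑ) > 0` for all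
  `σ ∈ Σ`, (d2) `𝔠(𝒪_𝓚) := 𝒟_𝓕⁻¹(2ϑ𝒟_{𝓚/𝓕}⁻¹)` is prime to `𝔇`"; `ℭ⁺ = 𝔉𝔉_c`, `(𝔉, 𝔉_c) = 1`,
  `𝔉 ⊂ 𝔉_c^c`; §3.2: "for each split `v ∣ p𝔉𝔉^c` we decompose `v = w w̄` with `w ∣ 𝔉Σ_p` … by (d2) we
  may choose `d_{𝓕_v} = −2ϑ_w` if `w ∣ 𝔉Σ_p`" (`d_𝓕` a finite idele generating `𝒟_𝓕`).
* §4.1: "`χ` a Hecke character of infinity type `kΣ + κ(1−c)`, where `k ≥ 1` is an integer and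
  `κ = ∑ κ_σ σ ∈ ℤ[Σ]`, `κ_σ ≥ 0`. We suppose that `ℭ` is divisible by the prime-to-`p` conductor of
  `χ`"; §4.7: "`Eul_p(χ) := ∏_{w ∈ Σ_p} Eul(χ_w)`, `Eul_{ℭ⁺}(χ) := ∏_{w ∣ 𝔉} Eul(χ_w)`, where
  `Eul(χ_w) := χ_w(2ϑ_w) · L(0, χ_w) / (ε(0, χ_w, ψ) · L(1, χ_w⁻¹))`"; Prop. 4.8:
  `l_𝓚(E^{nh}_χ) = 2^r · L^{(pℭ)}(0, χ) · Eul_p(χ) Eul_{ℭ⁺}(χ)`; §4.8: the measure `𝓛_{ℭ,Σ}` and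
  "if `χ̂` is the avatar of a Hecke character `χ` of infinity type `kΣ + κ(1 − c)`, then" the
  displayed integral; **Prop. 4.9** = the §1 display with the extra factor `t_𝓚` ("a power of `2`");
  Remark 4.10: "agrees with the measure constructed in [HT93] up to a product of local Gauss sums at
  `v ∣ 𝔉𝔉^c` and `t_𝓚`, both of which are units."
* Infinity types (Hsieh, Doc. Math. 19 (2014) p. 711, same author and conventions): "`χ` of infinity
  type `(k₁, k₂)` … if `χ_∞(z) = z^{k₁−k₂}(z z̄)^{k₂}`" — an IDELIC convention, per `σ ∈ Σ`.
* The consumer shape (Hsieh, J. Amer. Math. Soc. 27 (2014), §6.5, citing "[Kat78], [HT93, Thm. II]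
  (cf. [Hsi14, Prop. 4.9])"): "to `(ψ, Σ)` we can associate a `(d+1)`-variable primitive `p`-adic Hecke
  `L`-function `L(Ψ, Σ) ∈ Λ`", `Λ = W⟦Γ_K⟧`, `Γ_K ≅ ℤ_p^{d+1}`, on the BRANCH of `ψ`.

## What is typed, and why it follows from the page (binder by binder)

* (T1) THE BRANCH ALONG A `ℤ_pⁿ`-QUOTIENT. The measure on the ray class group `Z(ℭ)` (a profinite
  group with torsion; the tree has no completed group ring for it) is NOT typed; typed is, for a
  fixed Hecke character `λ` (the branch character) and a `ℤ_pⁿ`-quotient of `Γ_L = Gal(L̄/L)` given by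
  `κ₁,…,κₙ : ZpExtension L p` with a generator family `γ₁,…,γₙ` (`ZpExtension.IsTopGeneratorFamily`:
  `κᵢ(γⱼ) = δᵢⱼ`), the Amice transform `G ∈ 𝒪_{ℂ_p}⟦T₁,…,Tₙ⟧` (`Tⱼ ↔ γⱼ − 1`) of the push-forward of
  `λ̂ · 𝓛_{ℭ,Σ}` to `ℤ_pⁿ`: `G(r(γ₁) − 1, …, r(γₙ) − 1) = ∫_{Z(ℭ)} r λ̂ d𝓛_{ℭ,Σ}` for every character `r`
  of the quotient (`FactorsThroughFamily`) — exactly Hsieh's "pull-back of `𝓛_{ℭ,Σ}` along `χ`" (§1)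
  with `Γ⁻` replaced by an arbitrary `ℤ_pⁿ`-quotient (every `ℤ_p`-extension of `L` is unramified
  outside `p`, so `r` IS a character of `Z(ℭ)`). `λ̂ · 𝓛_{ℭ,Σ}` is `𝒪`-valued because `𝓛_{ℭ,Σ}` is
  (`Z̄_p`-valued) and `λ̂` takes unit values; an `𝒪_{ℂ_p}`-valued measure on `ℤ_pⁿ` is a bounded power
  series with `∫ r = G(r(e) − 1)` (Mahler). `n = d + 1` with Hsieh's `Γ_K`; `n = 1` is a `ℤ_p`-LINE
  (`IsLine`, receptacle `PowerSeries (PadicComplexInt p)` as every one-variable consumer in the tree).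
* (T2) `Σ` THROUGH `Σ_p`. A `p`-ordinary CM type is recorded by its `p`-adic CM type
  `Σ_p : Finset (HeightOneSpectrum (𝓞 L))` (`IsPAdicCMType`: above `p`, exactly one of `w, c w` —
  the hypothesis shape of the tree's `HeckeCharacter.cmExponent_add_cmExponent_conjugate`), and
  `σ ∈ Σ ↔ place(ι⁻¹ ∘ σ) ∈ Σ_p` (`InSigma`, via the tree's `PadicEmbedding.place`) — for a `p`-ordinary
  `Σ` this IS Hsieh's `Σ ↔ Σ_p`. (ord) is implied by `IsPAdicCMType` (a `c`-fixed place above `p`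
  would violate it) and is not a separate binder.
* (T3) TYPE. Hsieh's idelic "infinity type `kΣ + κ(1−c)`" is `χ_∞(z) = ∏_{σ∈Σ} z_σ^{k+κ_σ} z̄_σ^{−κ_σ}`
  (Doc. Math. convention above, per `σ ∈ Σ`); the tree reads types through `HasInfinityType (p, q)`,
  `χ((x,1)) = ∏_w σ_w(x)^{−p_w} σ̄_w(x)^{−q_w}` (`σ_w = w.embedding`), i.e. through the exponent function
  `n ∈ ℤ[Hom(L,ℂ)]`, `χ_∞ = ∏_φ φ^{−n_φ}` (`HeckeCharacter.typeOfExponent`). Hence `n(σ) = −(k+κ_σ)`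
  (`σ ∈ Σ`), `n(σ̄) = κ_σ` (`katzExponent`, `HasKatzType`); `κ` is indexed by the infinite places
  (`w ↦ σ_w ∈ Σ`, `embeddingAt`). For `d = 1` this is the tree's de Shalit type `(−m, j)`,
  `m = k + κ`, `j = κ`, and Hsieh's region "`k ≥ 1`, `κ ≥ 0`" is de Shalit's `0 ≤ j < m` — the SAME
  range as `DeShalit1987.IsKatzBranch` (consistency check: at `[L:ℚ] = 2`, `ϑ = √d_K/2`, the factor
  `π^κ/(Im ϑ)^κ = (2π/√|d_K|)^j` and `Γ_Σ = Γ(m)` are de Shalit's, ERRATUM F-GAMMA of that file).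
  The second region "`k ≤ 1`, `kΣ + κ > 0`" is NOT typed.
* (T4) THE RANGE AND THE LOCAL FACTORS AT `Σ_p ∪ supp 𝔉` — THE POINT OF THIS FILE. The sibling
  frames interpolate only at characters `χ` UNRAMIFIED at `p` (so that no Gauss sum appears). On a
  branch whose character `λ` is TAMELY ramified at `w ∈ Σ_p` by a character of the residue field not
  factoring through the norm to `𝔽_p` (the requesting line: `λ = ψ_W ∘ N_{L/K}` for a CM elliptic curve
  `W/ℚ` with additive reduction at `p` inert in `K`, a supercuspidal type), a point `λρ` is unramified
  at `w` only if `ρ_w` cancels that character on the roots of unity of `L_w`; along a `ℤ_p`-line whose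
  avatars are restricted from an imaginary quadratic subfield `K′` with `p` split (the "`K′`-line":
  equal Hodge–Tate weights at the two embeddings through `w`, so `ρ_w|_{μ(L_w)}` factors through the
  norm) NO point qualifies, and a range cut down to `χ` unramified above `p` would be VACUOUS there (in
  `≥ 2` anticyclotomic variables such points exist, on congruence classes of weights). Instead the
  typed range is `χ = λρ` with `ρ` UNRAMIFIED AT EVERY FINITE PLACE (and `r = ρ̂` through the family):
  then `χ_w|_{𝒪_wˣ} = λ_w|_{𝒪_wˣ}` is CONSTANT along the range, and by the standard twisting rule for
  Tate's local constant by an unramified character,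
  `ε(0, λ_wρ_w, ψ_w) = ρ_w(ϖ_w)^{a(λ_w) + n(ψ_w)} · ε(0, λ_w, ψ_w)` (`a` = conductor exponent, the
  tree's `HeckeCharacter.conductorExponentAt`; `n(ψ_w) = d_w` the different exponent of `L_w = 𝓕_v/ℚ_p` for
  `ψ = ψ_ℚ ∘ Tr`), while `χ_w(2ϑ_w) = λ_w(2ϑ) ρ_w(ϖ_w)^{ord_w(2ϑ)} = λ_w(2ϑ) ρ_w(ϖ_w)^{d_w}` by (d2)
  (§3.2: `d_{𝓕_v} = −2ϑ_w` at `w ∣ 𝔉Σ_p`). Hence ON THE RANGE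
  `Eul(χ_w) = c_w(λ, ϑ) · ρ_w(ϖ_w)^{−a(λ_w)} · L(0, χ_w)/L(1, χ_w⁻¹)`,
  `c_w(λ, ϑ) = λ_w(2ϑ)/ε(0, λ_w, ψ_w) ∈ ℚ̄^×` INDEPENDENT of `ρ` (`eulerFactor` is the `ρ`-dependent
  part; `L(0,χ_w)/L(1,χ_w⁻¹) = (1 − χ_w(ϖ)⁻¹q_w⁻¹)/(1 − χ_w(ϖ))` or `1`). The constants `c_w`
  (`w ∈ Σ_p ∪ supp 𝔉`), `[𝒪_L^× : 𝒪_𝓕^×] t_L/√|D_𝓕|` (and Hsieh's `2^r`, Haar normalisations) are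
  collected in ONE constant `C ∈ ℂ^×` of the frame, existential in the fact — the device of
  `IsHsiehLFunction`'s `C`. No Gauss sum is typed, yet tame branches have Zariski-many points.
* (T5) `L^{(pℭ)}(0, χ)`: Euler factors at ALL `w ∣ pℭ` removed from the tree's `heckeLFunction χ`
  (`= ∏'_{v unramified}(1 − χ(ϖ_v)Nv^{−s})⁻¹`, Hsieh's `L(s, χ)`), value at `0` through a binder
  `hL : HasEntireContinuation` (weight `−k ≤ −1`: genuine Euler product on `re s > 1`, entire, unique
  continuation — as in the sibling files); removed factors `∏_{w ∈ S ∪ {w∣p}}(1 − χ̃(w))` by the tree's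
  `DeShalit1987.removedEulerFactorsAtZero`, `S := supp ℭ`. Only the SUPPORTS of `ℭ` and `𝔉` enter the
  display, so the modulus is carried as two finsets `S ⊇ T` (`T := supp 𝔉`); the values for `ℭ^m`,
  `m ≫ 0`, are literally the same (as in `IsKatzBranch`, (T1) there).
* (T6) AVATAR AND EVALUATION POINT: Hsieh's `χ̂` is the avatar "via geometrically normalized
  reciprocity law", which is the tree's `IsPAdicAvatarOf` (`r(Frob^{geom}_v) = ι⁻¹(ρ(ϖ_v))`,
  Castella–Hsieh's `χ̂ ∘ rec`); so `∫ χ̂ d𝓛 = ∫ λ̂ r d𝓛 = G(r(γ) − 1)` with NO inversion (contrast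
  de Shalit's `∫ ε⁻¹`, (T6) of that file).
* (T7) PERIODS AND `ι⁻¹`: `Ω_∞ ∈ (ℂ^×)^Σ`, `Ω_p ∈ (Z̄_p^×)^Σ` are indexed by the infinite places;
  `Ω^{kΣ+2κ} = ∏_w Ω_w^{k+2κ_w}`; the right side of Prop. 4.9 lies in `ℚ̄` (it is `Ω_p^{−kΣ−2κ}`
  times a `p`-adic integral), so transporting the WHOLE complex display by the field isomorphism
  `ι⁻¹ : ℂ → ℚ̄_p` is Hsieh's `ι_p = ι⁻¹ ∘ ι_∞` on it, whatever `ι` does to transcendentals.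
* (T8) THE FACT quantifies `C, Ω_∞, Ω_p, G` EXISTENTIALLY and innermost (weaker than print, where the
  periods depend on `(L, Σ)` only), with `C ≠ 0`, `Ω_{∞,w} ≠ 0`, `‖Ω_{p,w}‖ = 1`; hypotheses (H):
  `2 < p ∤ D_𝓕` ((unr), `𝓕 = maximalRealSubfield L`), `IsCMField L`, `IsPAdicCMType p Σ_p` ((ord)),
  (d1) as "every embedding value of `ϑ` is purely imaginary" (equivalent to `ϑ^c = −ϑ` on a CM field)
  and `Im σ(ϑ) > 0` on `Σ`, (d2) as `ord_w(2ϑ) = ord_w(𝒟_{L/ℚ})` (`ordAt`, `differentExponentAt`;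
  `𝒟_{L/ℚ} = 𝒟_{L/𝓕} · 𝒟_𝓕𝒪_L`) at every `w` of a finset `D ⊇ {w ∣ p} ∪ S ∪ cS ∪ {w ramified in L/𝓕}`
  (`Ideal.ramificationIdx (𝓞 𝓕) ≠ 1`; `D ⊇ supp 𝔇`, a larger `D` only strengthens the hypothesis),
  `S` away from `p`, `T ⊆ S` with `c w ≠ w`, `c w ∉ T` for `w ∈ T` and `w ∈ T ∨ c w ∈ T` for every
  split `w ∈ S` (`𝔉`), `λ` unramified outside `S ∪ {w ∣ p}` ("modulo `ℭp^∞`"), any family.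

## What is NOT typed (deliberately)

The measure `𝓛_{ℭ,Σ}` on `Z(ℭ)` and its uniqueness; interpolation points with `ρ` ramified (Gauss
sums / `ε(0, χ_w, ψ)` as functions of `χ`); the second critical region; the functional equation;
`Z̄_p`- or `W`-rationality of `G` beyond `𝒪_{ℂ_p}`; the dependence of the periods on `(L, Σ)` alone;
the restriction lemma "an `n`-variable frame restricts to a line frame" (substitution
`Tᵢ ↦ (1+T)^{cᵢ} − 1`); any comparison with `IsHsiehLFunction` on the `K′`-line of a biquadratic
field (the requesting line's (E1a)) or with Hida–Tilouine's `W_p(λ)`. `ordAt v 0 = 0` (junk);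
`conductorExponentAt` (tree) is an `sInf` with junk `0` off continuous characters.

## References

* [Hsieh2014mu] M.-L. Hsieh, *On the μ-invariant of anticyclotomic p-adic L-functions for CM
  fields*, J. reine angew. Math. 688 (2014), 67–100 (arXiv:1112.1574): §1, §1.1–1.3, §3.1–3.2,
  §4.1, §4.7 (Prop. 4.8), §4.8 (Prop. 4.9, Remark 4.10).
* [Katz1978] N. M. Katz, *p-adic L-functions for CM fields*, Invent. Math. 49 (1978), Thm. (5.3.0).
* [HidaTilouine1993] H. Hida, J. Tilouine, *Anti-cyclotomic Katz p-adic L-functions and congruence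
  modules*, Ann. Sci. ÉNS 26 (1993), Thm. II.
* M.-L. Hsieh, *Eisenstein congruence on unitary groups and Iwasawa main conjectures for CM fields*,
  J. Amer. Math. Soc. 27 (2014), §6.5 (consumer shape `L(Ψ, Σ) ∈ Λ`); *Special values of
  anticyclotomic Rankin–Selberg L-functions*, Doc. Math. 19 (2014), p. 711 (infinity types).
* J. Tate, *Fourier analysis in number fields* (1950/1967), §2 (local constants; the unramified twist
  rule); P. Deligne, *Les constantes des équations fonctionnelles des fonctions L* (1973), §3, (5.5).
-/

noncomputable section

open scoped Classical nonZeroDivisors Pointwise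
open NumberField IsDedekindDomain Field Polynomial
open Literature.NumberTheory.GaloisRepresentations

namespace Literature.NumberTheory.EllipticCurves

universe u

/-! ### §1. The `n`-variable receptacle `𝒪_{ℂ_p}⟦T₁, …, Tₙ⟧` and values at points of the polydisc -/

section Receptacle

variable {p : ℕ} [Fact p.Prime] {n : ℕ}

/-- **The value of `G ∈ 𝒪_{ℂ_p}⟦T₁,…,Tₙ⟧` at a point `x` of the open unit polydisc of `ℂ_pⁿ`**:
`∑_e [T^e]G · ∏ᵢ xᵢ^{eᵢ} = v` as a `HasSum` over `Fin n →₀ ℕ` (absolutely convergent for all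
`‖xᵢ‖ < 1`). The `n`-variable twin of the tree's `IntSeries.HasValueAt` (`n = 1`) and
`IntSeries.HasValueAt₂` (`n = 2`): an `𝒪_{ℂ_p}`-valued measure `ν` on `ℤ_pⁿ` IS such a `G`
(`G(T) = ∫ ∏ᵢ (1 + Tᵢ)^{xᵢ} dν`, Mahler/Amice), and for a continuous character `r` of `ℤ_pⁿ`,
`∫ r dν = G(r(e₁) − 1, …, r(eₙ) − 1)` (Hsieh §5.1: the anticyclotomic projection `𝓛⁻_{χ,Σ}` on
`Γ⁻`, a `ℤ_p^d`-quotient, read as an element of `Λ = Z̄_p⟦Γ⁻⟧`; Washington §7.1, §12.2 for `n = 1`).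
[cite: Hsieh2014mu, §5.1 (the measure `𝓛⁻_{χ,Σ}` on `Γ⁻`)] [cite: Washington1997, §12.2 (Mahler–Amice: measures on `ℤ_p` as power series)] -/
def MvIntSeries.HasValueAt (G : MvPowerSeries (Fin n) (PadicComplexInt p)) (x : Fin n → ℂ_[p])
    (v : ℂ_[p]) : Prop :=
  HasSum (fun e : Fin n →₀ ℕ ↦
    ((MvPowerSeries.coeff e G : PadicComplexInt p) : ℂ_[p]) * ∏ i, x i ^ e i) v

/-- The value at a point is unique (a `HasSum` limit in the Hausdorff space `ℂ_p`).
[cite: Washington1997, §12.2] -/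
theorem MvIntSeries.HasValueAt.unique {G : MvPowerSeries (Fin n) (PadicComplexInt p)}
    {x : Fin n → ℂ_[p]} {v v' : ℂ_[p]} (h : MvIntSeries.HasValueAt G x v)
    (h' : MvIntSeries.HasValueAt G x v') : v = v' :=
  HasSum.unique h h'

end Receptacle

/-! ### §2. `ℤ_pⁿ`-quotients of `Γ_K`: generator families and characters factoring through them -/

section Family

variable {K : Type u} [Field K] {p : ℕ} [Fact p.Prime] {n : ℕ}

/-- **A topological generator FAMILY for `n` `ℤ_p`-extensions `κ₁, …, κₙ` of `K`**: elements
`γ₁, …, γₙ ∈ Γ_K` with `κᵢ(γⱼ) = δᵢⱼ ∈ ℤ_p`. Then `Γ_K → ℤ_pⁿ`, `σ ↦ (κᵢ σ)ᵢ` is onto (its image is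
a closed subgroup containing the standard basis), the compositum `K_∞` of the `κᵢ` has
`Gal(K_∞/K) = Γ_K/⋂ᵢ ker κᵢ ≅ ℤ_pⁿ` with `ℤ_p`-basis the images of the `γⱼ`, and
`𝒪⟦Gal(K_∞/K)⟧ ≅ 𝒪⟦T₁,…,Tₙ⟧`, `γⱼ ↦ 1 + Tⱼ` — Hsieh's `Γ_K ≅ ℤ_p^{d+1}`, `Λ = W⟦Γ_K⟧`
("`(d+1)`-variable Iwasawa algebra"). The cases `n = 1, 2` are the tree's `ZpExtension.IsTopGenerator`
(`isTopGeneratorFamily_one_iff`) and `ZpExtension.IsTopGeneratorPair` (Rubin 1991 file).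
[cite: Hsieh2014mu, §1 (Introduction: `Γ⁻` the maximal `ℤ_p`-free quotient) and §4.8] -/
def ZpExtension.IsTopGeneratorFamily (κs : Fin n → ZpExtension K p)
    (γs : Fin n → absoluteGaloisGroup K) : Prop :=
  ∀ i j, κs i (γs j) = Multiplicative.ofAdd (if i = j then (1 : ℤ_[p]) else 0)

/-- **`r` factors through the `ℤ_pⁿ`-quotient cut out by `κ₁, …, κₙ`**: `r` is trivial on
`⋂ᵢ ker κᵢ = Gal(K̄/K_∞)`, i.e. is (the inflation of) a character of `Gal(K_∞/K) ≅ ℤ_pⁿ` — the `p`-adic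
Galois characters "factoring through `Γ_K`" of Hsieh's `Λ`. The `n`-generator twin of
`FactorsThroughZp` (`factorsThroughFamily_one_iff`) and `FactorsThroughPair`.
[cite: Hsieh2014mu, §1 (Introduction) and §4.8] -/
def FactorsThroughFamily {A : Type*} [CommRing A] [TopologicalSpace A]
    (κs : Fin n → ZpExtension K p) (r : FramedGaloisRep K A 1) : Prop :=
  ∀ σ : absoluteGaloisGroup K, (∀ i, κs i σ = 1) → r σ = 1

/-- A one-member family is a topological generator in the sense of `ZpExtension.IsTopGenerator`.
[cite: Washington1997, §13.1 (`ℤ_p`-extensions, topological generators)] -/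
theorem ZpExtension.isTopGeneratorFamily_one_iff (κ : ZpExtension K p) (γ : absoluteGaloisGroup K) :
    ZpExtension.IsTopGeneratorFamily (fun _ : Fin 1 ↦ κ) (fun _ ↦ γ) ↔ κ.IsTopGenerator γ := by
  simp [ZpExtension.IsTopGeneratorFamily, ZpExtension.IsTopGenerator]

/-- Factoring through a one-member family is `FactorsThroughZp`. [cite: Washington1997, §13.1] -/
theorem factorsThroughFamily_one_iff {A : Type*} [CommRing A] [TopologicalSpace A]
    (κ : ZpExtension K p) (r : FramedGaloisRep K A 1) :
    FactorsThroughFamily (fun _ : Fin 1 ↦ κ) r ↔ FactorsThroughZp κ r := by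
  simp [FactorsThroughFamily, FactorsThroughZp]

/-- If `r` factors through the family then `r(σ) = 1 ∈ ℂ_p` on `⋂ᵢ ker κᵢ`. [cite: Washington1997, §13.1] -/
theorem avatarValueAt_eq_one_of_factorsThroughFamily {κs : Fin n → ZpExtension K p}
    {r : FramedGaloisRep K (PadicAlgCl p) 1} (h : FactorsThroughFamily κs r)
    {σ : absoluteGaloisGroup K} (hσ : ∀ i, κs i σ = 1) : avatarValueAt r σ = 1 := by
  rw [avatarValueAt, h σ hσ]
  simp

end Family

/-! ### §3. `p`-adic CM types `Σ_p`, the CM type `Σ` they cut out, and the type `kΣ + κ(1 − c)` -/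

section CMTypes

variable {L : Type} [Field L] [NumberField L] {p : ℕ} [Fact p.Prime]

namespace KatzCM

/-- **`σ ∈ Σ`** for the CM type `Σ = {σ : L → ℂ | the place above `p` of the `p`-adic embedding
`ι⁻¹ ∘ σ` lies in `Σ_p`}` determined by a `p`-adic CM type `Σ_p` and the embedding datum
`ι : ℚ̄_p ≃ ℂ` (`ι_p = ι⁻¹ ∘ ι_∞`): Hsieh's "`Σ_p = {w ∣ p : w` is induced by `ι_p ∘ σ` for `σ ∈ Σ}`"
read backwards — for a `p`-ORDINARY `Σ` (`Σ_p ∩ Σ_p c = ∅`) the type `Σ` is recovered from `Σ_p` this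
way. The place of a `p`-adic embedding is the tree's `PadicEmbedding.place`; the same dictionary as
`HeckeCharacter.cmExponent` (`CMTypeHeckeCharacter`, "the CM type `T_Φ` of a CM type of places").
[cite: Hsieh2014mu, §1.1 (`Σ_p`, `p`-ordinary CM types)] -/
def InSigma (ι : PadicAlgCl p ≃+* ℂ) (Sp : Finset (HeightOneSpectrum (𝓞 L))) (σ : L →+* ℂ) :
    Prop :=
  PadicEmbedding.place ((ι.symm : ℂ ≃+* PadicAlgCl p).toRingHom.comp σ) ∈ Sp

/-- **`Σ_p` is a `p`-adic CM type** (the set of places above `p` of a `p`-ordinary CM type): every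
member lies above `p`, and of each pair `{w, c w}` of places above `p` exactly one is in `Σ_p`
("`Σ_p` and its complex conjugation `Σ_p c` give a partition of the set of places of `K` lying above
`p`" — this forces (ord): every prime of the maximal real subfield above `p` splits in `L`). The
shape is verbatim the hypothesis `hΦ` of the tree's `HeckeCharacter.cmExponent_add_cmExponent_conjugate`;
`c` is Mathlib's `NumberField.IsCMField.complexConj L` acting on places.
[cite: Hsieh2014mu, §1.1 ((ord); `Σ_p ∩ Σ_p c = ∅`, `Σ_p ∪ Σ_p c =` all places above `p`)] -/
def IsPAdicCMType [IsCMField L] (p : ℕ) [Fact p.Prime] (Sp : Finset (HeightOneSpectrum (𝓞 L))) :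
    Prop :=
  (∀ w ∈ Sp, ((p : ℕ) : 𝓞 L) ∈ w.asIdeal) ∧
    ∀ w : HeightOneSpectrum (𝓞 L), ((p : ℕ) : 𝓞 L) ∈ w.asIdeal →
      (w ∈ Sp ↔ IsCMField.complexConj L • w ∉ Sp)

/-- **The element `σ_w ∈ Σ` at the infinite place `w`**: Mathlib's embedding `w.embedding` of the
place if it lies in `Σ`, else its conjugate (for a CM type exactly one of the two does; Hsieh
"identif[ies] `Σ` with the archimedean places by restriction"). Used to read `Im σ(ϑ)`, `σ ∈ Σ`.
[cite: Hsieh2014mu, §1.1] -/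
def embeddingAt (ι : PadicAlgCl p ≃+* ℂ) (Sp : Finset (HeightOneSpectrum (𝓞 L)))
    (w : InfinitePlace L) : L →+* ℂ :=
  if InSigma ι Sp w.embedding then w.embedding
  else NumberField.ComplexEmbedding.conjugate w.embedding

/-- `σ_w` induces the place `w`. [cite: Hsieh2014mu, §1.1] -/
theorem mk_embeddingAt (ι : PadicAlgCl p ≃+* ℂ) (Sp : Finset (HeightOneSpectrum (𝓞 L)))
    (w : InfinitePlace L) : InfinitePlace.mk (embeddingAt ι Sp w) = w := by
  unfold embeddingAt
  split_ifs
  · exact InfinitePlace.mk_embedding w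
  · rw [InfinitePlace.mk_conjugate_eq, InfinitePlace.mk_embedding]

/-- **The exponent function of the infinity type `kΣ + κ(1 − c)`** (`k ≥ 0`, `κ = ∑_σ κ_σ σ ∈ ℤ_{≥0}[Σ]`,
indexed here by the infinite places `w ↔ σ_w ∈ Σ`; the frames impose `k ≥ 1`), in the tree's convention for exponent
functions `n ∈ ℤ[Hom(L, ℂ)]` (`HeckeCharacter.embExponent` / `typeOfExponent`:
`χ((x, 1)) = ∏_φ φ(x)^{−n_φ}` near `1`). Hsieh's idelic infinity type `kΣ + κ(1 − c)` means
`χ_∞(z) = ∏_{σ ∈ Σ} z_σ^{k + κ_σ} z̄_σ^{−κ_σ}` (his "`χ` of infinity type `(k₁, k₂)` if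
`χ_∞(z) = z^{k₁−k₂}(z z̄)^{k₂}`", Doc. Math. 19 p. 711, per `σ ∈ Σ`), hence
`n(σ) = −(k + κ_σ)` for `σ ∈ Σ` and `n(σ̄) = κ_σ` — for `[L:ℚ] = 2`, `Σ = {σ_w}` this is the tree type
`(p, q) = (−(k+κ), κ) = (−m, j)` of `DeShalit1987.IsKatzBranch` (`m = k + κ`, `j = κ`), and Hsieh's
critical region "`k ≥ 1` and `κ ∈ ℤ_{≥ 0}[Σ]`" is de Shalit's `0 ≤ j < m`.
[cite: Hsieh2014mu, §1 (Introduction, (i)) and §4.1 ("infinity type `kΣ + κ(1−c)`, `k ≥ 1`, `κ_σ ≥ 0`")] -/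
def katzExponent (ι : PadicAlgCl p ≃+* ℂ) (Sp : Finset (HeightOneSpectrum (𝓞 L))) (k : ℕ)
    (κ : InfinitePlace L → ℕ) (φ : L →+* ℂ) : ℤ :=
  if InSigma ι Sp φ then -((k : ℤ) + κ (InfinitePlace.mk φ)) else (κ (InfinitePlace.mk φ) : ℤ)

/-- **`χ` has infinity type `kΣ + κ(1 − c)`**: the tree's `HasInfinityType` at the place-indexed type
`(p, q) = typeOfExponent (katzExponent ι Σ_p k κ)` (`p_w = n(σ_w)`, `q_w = n(σ̄_w)`).
[cite: Hsieh2014mu, §1 (Introduction, (i)) and §4.1] -/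
def HasKatzType (ι : PadicAlgCl p ≃+* ℂ) (Sp : Finset (HeightOneSpectrum (𝓞 L)))
    (χ : HeckeCharacter L) (k : ℕ) (κ : InfinitePlace L → ℕ) : Prop :=
  χ.HasInfinityType (HeckeCharacter.typeOfExponent (katzExponent ι Sp k κ)).1
    (HeckeCharacter.typeOfExponent (katzExponent ι Sp k κ)).2

/-- **The primes of `L` above `p`** as a `Finset` (finitely many: the prime factors of `p𝒪_L`).
[cite: NeukirchANT1999, Ch. I §8] -/
def primesOver (L : Type) [Field L] [NumberField L] (p : ℕ) [Fact p.Prime] :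
    Finset (HeightOneSpectrum (𝓞 L)) :=
  (Ideal.finite_factors (I := Ideal.span {((p : ℕ) : 𝓞 L)})
    (by
      rw [Ne, Ideal.zero_eq_bot, Ideal.span_singleton_eq_bot]
      exact_mod_cast (Fact.out : p.Prime).ne_zero)).toFinset

/-- Membership in `primesOver`: `w ∣ p` (the prime factors of `p𝒪_L`). [cite: NeukirchANT1999, Ch. I §8 (prime decomposition)] -/
theorem mem_primesOver {w : HeightOneSpectrum (𝓞 L)} :
    w ∈ primesOver L p ↔ ((p : ℕ) : 𝓞 L) ∈ w.asIdeal := by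
  rw [primesOver, Set.Finite.mem_toFinset, Set.mem_setOf_eq, Ideal.dvd_span_singleton]

end KatzCM

end CMTypes

/-! ### §4. Local data at a finite place: orders of elements and of the different

(The conductor exponent `a(χ_v)` is the tree's `HeckeCharacter.conductorExponentAt`,
`HeckeCharacterConductorExponent.lean`, convention `0 ⟺` unramified.) -/

section Local

variable {K : Type u} [Field K] [NumberField K]

/-- **`ord_v(x) ∈ ℤ`** for `x ∈ K`: the exponent of `v` in the fractional ideal `(x)` (Mathlib's
`FractionalIdeal.count`; `0` at `x = 0`, junk). [cite: NeukirchANT1999, Ch. I §11 (valuations attached to prime ideals)] -/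
def ordAt (v : HeightOneSpectrum (𝓞 K)) (x : K) : ℤ :=
  FractionalIdeal.count K v (FractionalIdeal.spanSingleton (𝓞 K)⁰ x)

/-- **The exponent `d_v` of `v` in the absolute different `𝒟_{K/ℚ}`** (Mathlib's
`differentIdeal ℤ (𝓞 K)`); for `v ∣ p` this is the different exponent of `K_v/ℚ_p`, i.e. the
conductor exponent `n(ψ_v)` of the additive character `ψ_v = ψ_{ℚ_p} ∘ Tr_{K_v/ℚ_p}`.
[cite: NeukirchANT1999, Ch. III §2 (the different)] -/
def differentExponentAt (v : HeightOneSpectrum (𝓞 K)) : ℤ :=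
  FractionalIdeal.count K v
    ((differentIdeal ℤ (𝓞 K) : Ideal (𝓞 K)) : FractionalIdeal (𝓞 K)⁰ K)

end Local

/-! ### §5. The complex side of Hsieh's Prop. 4.9 at a character of the typed range -/

section Display

variable {L : Type} [Field L] [NumberField L] {p : ℕ} [Fact p.Prime]

namespace KatzCM

/-- **The `ρ`-dependent part of Hsieh's modified Euler factor `Eul(χ_w)`, `χ = λρ`, at a place
`w ∈ Σ_p ∪ supp(𝔉)`, for `ρ` UNRAMIFIED at `w`** (module docstring (T4)):
`ρ_w(ϖ_w)^{−a(λ_w)} · L(0, χ_w) / L(1, χ_w⁻¹)`, where `L(0, χ_w)/L(1, χ_w⁻¹) =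
(1 − χ_w(ϖ)⁻¹ q_w⁻¹)/(1 − χ_w(ϖ))` if `χ_w` is unramified and `= 1` otherwise (both via the tree's
value-extended-by-zero `heckeValueExtZero`, `0⁻¹ = 0`), `a(λ_w)` the conductor exponent and
`ρ_w(ϖ_w) = ρ.valueAtUniformizer w` (independent of the uniformiser as `ρ` is unramified). Hsieh's
`Eul(χ_w) := χ_w(2ϑ_w) · L(0, χ_w) / (ε(0, χ_w, ψ) · L(1, χ_w⁻¹))` equals `c_w(λ, ϑ) ·` this, with
`c_w(λ, ϑ) = λ_w(2ϑ) / ε(0, λ_w, ψ_w)` INDEPENDENT of `ρ` (absorbed into the frame's constant `C`):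
`ε(0, λ_w ρ_w, ψ_w) = ρ_w(ϖ_w)^{a(λ_w) + d_w} ε(0, λ_w, ψ_w)` for unramified `ρ_w` and
`χ_w(2ϑ_w) = λ_w(2ϑ) ρ_w(ϖ_w)^{d_w}` by (d2) (`ord_w(2ϑ) = d_w`, the different exponent).
[cite: Hsieh2014mu, §4.7 (`Eul(χ_w)`, `Eul_p`, `Eul_{𝔠⁺}`, before Prop. 4.8) and §3.2 (d2) with "`d_{F_v} = −2ϑ_w` if `w ∣ 𝔉Σ_p`"] -/
def eulerFactor (lam ρ : HeckeCharacter L) (w : HeightOneSpectrum (𝓞 L)) : ℂ :=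
  (ρ.valueAtUniformizer w) ^ (-(lam.conductorExponentAt w : ℤ)) *
    ((1 - heckeValueExtZero (lam * ρ)⁻¹ w * ((w.residueCard : ℂ))⁻¹) /
      (1 - heckeValueExtZero (lam * ρ) w))

/-- **The archimedean and period factor of Prop. 4.9 at the type `kΣ + κ(1 − c)`**:
`π^κ · Γ_Σ(kΣ + κ) / ((Im ϑ)^κ · Ω_∞^{kΣ + 2κ})`
`= π^{∑_w κ_w} · ∏_w Γ(k + κ_w) · (∏_w (Im σ_w(ϑ))^{κ_w})⁻¹ · (∏_w Ω_w^{k + 2κ_w})⁻¹`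
(`σ_w ∈ Σ` the embedding at `w`, `embeddingAt`; `Γ(k + κ_w)` is the tree's
`DeShalit1987.gammaFactorAtZero (k + κ_w)`). For `[L:ℚ] = 2`, `ϑ = √d_K/2` this is de Shalit's
`Γ(m) (2π/√|d_K|)^j / Ω^{m+j}` (`DeShalit1987.interpolationValue`, ERRATUM F-GAMMA there).
[cite: Hsieh2014mu, Prop. 4.9 (§4.8) and §1 (Introduction, display)] -/
def archFactor (ι : PadicAlgCl p ≃+* ℂ) (Sp : Finset (HeightOneSpectrum (𝓞 L))) (k : ℕ)
    (κ : InfinitePlace L → ℕ) (ϑ : L) (Ω : InfinitePlace L → ℂ) : ℂ :=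
  (Real.pi : ℂ) ^ (∑ w, κ w) * (∏ w, DeShalit1987.gammaFactorAtZero (k + κ w)) *
    (∏ w, (((embeddingAt ι Sp w ϑ).im : ℝ) : ℂ) ^ κ w)⁻¹ * (∏ w, Ω w ^ (k + 2 * κ w))⁻¹

/-- **The complex part of Hsieh's interpolation value (Prop. 4.9 / §1 display) at `χ = λρ` of the
typed range** (type `kΣ + κ(1 − c)`, `k ≥ 1`, `κ ≥ 0`; `ρ` unramified; module docstring (T1)–(T7)):

  `C · archFactor · L^{(p𝔠)}(0, χ) · ∏_{w ∈ Σ_p ∪ supp 𝔉} eulerFactor λ ρ w`,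

where `L^{(p𝔠)}(0, χ) = ∏_{w ∈ S ∪ {w ∣ p}} (1 − χ̃(w)) · L(χ, 0)` (Euler factors at `p𝔠` removed;
`S = supp 𝔠`; the tree's `DeShalit1987.removedEulerFactorsAtZero`), `Lval = L(χ, 0)` supplied by the
caller (in the frames: the entire continuation of the tree's `heckeLFunction χ` at `0`), and
`C ∈ ℂ` the constant collecting `[𝒪_L^× : 𝒪_F^×] · t_L / √|D_F|` and the local constants
`c_w(λ, ϑ)`, `w ∈ Σ_p ∪ supp 𝔉` (`eulerFactor`). The `p`-adic value is `ι⁻¹` of this times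
`Ω_p^{kΣ + 2κ} = ∏_w Ω_{p,w}^{k + 2κ_w}`. [cite: Hsieh2014mu, Prop. 4.9 (§4.8), §1 (Introduction, display), §4.7 (Prop. 4.8, `Eul`)] -/
def interpolationValue (ι : PadicAlgCl p ≃+* ℂ) (Sp S T : Finset (HeightOneSpectrum (𝓞 L)))
    (lam ρ : HeckeCharacter L) (k : ℕ) (κ : InfinitePlace L → ℕ) (ϑ : L) (C : ℂ)
    (Ω : InfinitePlace L → ℂ) (Lval : ℂ) : ℂ :=
  C * archFactor ι Sp k κ ϑ Ω *
    DeShalit1987.removedEulerFactorsAtZero (lam * ρ) (S ∪ primesOver L p) *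
    (∏ w ∈ Sp ∪ T, eulerFactor lam ρ w) * Lval

end KatzCM

end Display

/-! ### §6. The characterising predicates: the `λ`-branch along a `ℤ_pⁿ`-quotient, and along a line -/

section Frame

variable {L : Type} [Field L] [NumberField L] {p : ℕ} [Fact p.Prime] {n : ℕ}

namespace KatzCM

/-- **The `λ`-twisted branch of the Katz–Hida–Tilouine measure `𝓛_{𝔠,Σ}` of `(L, Σ)` along the
`ℤ_pⁿ`-quotient `(κ₁,…,κₙ; γ₁,…,γₙ)` of `Γ_L`, as a CHARACTERISING PREDICATE on
`G ∈ 𝒪_{ℂ_p}⟦T₁,…,Tₙ⟧` (`1 + Tⱼ ↔ γⱼ`)** — Hsieh, Crelle 688, Prop. 4.9 / §1 display, read on the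
range (module docstring (T1)–(T8)): for every Hecke character `ρ` of `L`, UNRAMIFIED at all finite
places, with a `p`-adic avatar `r` (`IsPAdicAvatarOf ι ρ r`, geometric normalisation — Hsieh's `ρ̂`)
factoring through the family (`FactorsThroughFamily κs r`), such that `χ := λρ` has infinity type
`kΣ + κ(1 − c)` with `k ≥ 1`, `κ ≥ 0` (`HasKatzType`), and for every entire continuation `hL` of
the tree's `L(χ, s)` (a binder; the value is unique), the value of `G` at
`T = (r(γ₁) − 1, …, r(γₙ) − 1)` is

  `∫ χ̂ d𝓛_{𝔠,Σ} = ι⁻¹(interpolationValue ι Σ_p S T λ ρ k κ ϑ C Ω (L(χ, 0))) · ∏_w Ω_{p,w}^{k + 2κ_w}`.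

Parameters: `ι : ℚ̄_p ≃ ℂ`; `Σ_p` (meant: a `p`-adic CM type, `IsPAdicCMType`); `S` (meant: the
support of the prime-to-`p` modulus `𝔠`), `T ⊆ S` (meant: the support of `𝔉`, `𝔠⁺ = 𝔉𝔉_c`); the
family `κs, γs`; the branch character `λ` (ANY ramification at `Σ_p ∪ T` allowed — the point of
this frame, (T4)); `ϑ ∈ L` (meant: Hsieh's `ϑ` with (d1), (d2)); `C ∈ ℂ`, `Ω : w ↦ Ω_{∞,w} ∈ ℂ`,
`Ω_p : w ↦ Ω_{p,w} ∈ ℂ_p` (meant: a non-zero constant and the CM periods of `(L, Σ)`). A predicate,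
not a construction and not an existence claim (that is `hsieh2014mu_prop49_exists_isMeasure`).
[cite: Hsieh2014mu, Prop. 4.9 (§4.8), §1 (Introduction, display), §4.8 (the measure `𝓛_{𝔠,Σ}` on `Z(𝔠)` and `∫ χ̂ d𝓛_{𝔠,Σ}`)]
[cite: Katz1978, Thm. (5.3.0) (5.3.5)–(5.3.6)] [cite: HidaTilouine1993, Thm. II] -/
def IsMeasure (ι : PadicAlgCl p ≃+* ℂ) (Sp S T : Finset (HeightOneSpectrum (𝓞 L)))
    (κs : Fin n → ZpExtension L p) (γs : Fin n → absoluteGaloisGroup L)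
    (lam : HeckeCharacter L) (ϑ : L) (C : ℂ) (Ω : InfinitePlace L → ℂ)
    (Ωp : InfinitePlace L → ℂ_[p]) (G : MvPowerSeries (Fin n) (PadicComplexInt p)) : Prop :=
  ∀ (ρ : HeckeCharacter L) (r : FramedGaloisRep L (PadicAlgCl p) 1) (k : ℕ)
    (κ : InfinitePlace L → ℕ),
    IsPAdicAvatarOf ι ρ r → FactorsThroughFamily κs r → 1 ≤ k →
    HasKatzType ι Sp (lam * ρ) k κ →
    (∀ w : HeightOneSpectrum (𝓞 L), ρ.IsUnramifiedAt w) →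
    ∀ hL : LFunction.HasEntireContinuation (heckeLFunction (lam * ρ)),
      MvIntSeries.HasValueAt G (fun i ↦ avatarValueAt r (γs i) - 1)
        (((ι.symm (interpolationValue ι Sp S T lam ρ k κ ϑ C Ω (hL.continuation 0)) :
            PadicAlgCl p) : ℂ_[p]) * ∏ w, Ωp w ^ (k + 2 * κ w))

/-- **The same branch along ONE `ℤ_p`-extension `κ₁` of `L` (a `ℤ_p`-LINE of `Γ_L`), receptacle
`𝒪_{ℂ_p}⟦T⟧ = PowerSeries (PadicComplexInt p)` (`1 + T ↔ γ`)** — the currency of the tree's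
one-variable frames (`IsHsiehLFunction`, `DeShalit1987.IsKatzBranch`, `X11b.R1.IsBDPLFunctionInt`):
VERBATIM `IsMeasure` with the family replaced by `FactorsThroughZp κ₁ r` and the value read at
`T = r(γ) − 1` (`IntSeries.HasValueAt`). E.g. `κ₁` = the pull-back to `L` of the anticyclotomic
`ℤ_p`-extension of an imaginary quadratic subfield `K′ ⊂ L` (the "`K′`-line"), on which, for
`λ = ψ ∘ N_{L/K}` with `L = K·K′` biquadratic, the Hecke `L`-values `L(λ(φ∘N_{L/K′}), 0)` are
Rankin–Selberg values `L(θ_ψ/K′ ⊗ φ)`. The restriction of an `n`-variable frame to a line of its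
quotient is a line frame (substitution `Tᵢ ↦ (1+T)^{cᵢ} − 1`; not proved in this statements file).
[cite: Hsieh2014mu, Prop. 4.9 (§4.8) and §1 (Introduction: the anticyclotomic pull-back `𝓛⁻_{χ,Σ}` "along" a branch character)] -/
def IsLine (ι : PadicAlgCl p ≃+* ℂ) (Sp S T : Finset (HeightOneSpectrum (𝓞 L)))
    (κ₁ : ZpExtension L p) (γ : absoluteGaloisGroup L)
    (lam : HeckeCharacter L) (ϑ : L) (C : ℂ) (Ω : InfinitePlace L → ℂ)
    (Ωp : InfinitePlace L → ℂ_[p]) (G : PowerSeries (PadicComplexInt p)) : Prop :=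
  ∀ (ρ : HeckeCharacter L) (r : FramedGaloisRep L (PadicAlgCl p) 1) (k : ℕ)
    (κ : InfinitePlace L → ℕ),
    IsPAdicAvatarOf ι ρ r → FactorsThroughZp κ₁ r → 1 ≤ k →
    HasKatzType ι Sp (lam * ρ) k κ →
    (∀ w : HeightOneSpectrum (𝓞 L), ρ.IsUnramifiedAt w) →
    ∀ hL : LFunction.HasEntireContinuation (heckeLFunction (lam * ρ)),
      IntSeries.HasValueAt G (avatarValueAt r γ - 1)
        (((ι.symm (interpolationValue ι Sp S T lam ρ k κ ϑ C Ω (hL.continuation 0)) :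
            PadicAlgCl p) : ℂ_[p]) * ∏ w, Ωp w ^ (k + 2 * κ w))

end KatzCM

end Frame

/-! ### §7. The named fact: existence of every twisted branch (Hsieh Prop. 4.9 with §4.8; Katz;
Hida–Tilouine) -/

section Fact

open KatzCM

/-- **Hsieh, J. reine angew. Math. 688 (2014), Prop. 4.9 with §4.8 (= Katz 1978 Thm. (5.3.0) /
Hida–Tilouine 1993 Thm. II in Hsieh's normalisation) — EXISTENCE of every twisted branch of the
measure `𝓛_{𝔠,Σ}` along every `ℤ_pⁿ`-quotient, named fact.** Hypotheses, as printed and transcribed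
(module docstring (T1)–(T8), (H)): `p > 2` with `p ∤ D_F` ((unr); `F = L⁺` the maximal real
subfield); `L` a CM field; `Σ_p` a `p`-adic CM type ((ord), `IsPAdicCMType`); `ϑ ∈ L` with (d1)
`ϑ^c = −ϑ` (every complex embedding value purely imaginary) and `Im σ(ϑ) > 0` for `σ ∈ Σ`, and (d2)
`ord_w(2ϑ) = ord_w(𝒟_{L/ℚ})` (i.e. `𝒟_F⁻¹ · 2ϑ · 𝒟_{L/F}⁻¹` prime to `w`) at every `w` in a finite set
`D` containing the primes above `p`, `S`, `c S` and the primes ramified in `L/F` (print: `D` = the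
support of `𝔇 = p𝔠𝔠^c D_{L/F}`; a larger `D` is a stronger hypothesis); `S = supp 𝔠` away from `p`;
`T = supp 𝔉 ⊆ S` containing exactly one of `w, c w` for each split `w ∈ S` and no `c`-fixed place;
`λ` unramified outside `S ∪ {w ∣ p}` (a character "modulo `𝔠p^∞`"); a generator family `(κs, γs)`.
Conclusion: there are `C ≠ 0`, periods `Ω_{∞,w} ≠ 0`, `Ω_{p,w}` with `‖Ω_{p,w}‖ = 1`, and
`G ∈ 𝒪_{ℂ_p}⟦T₁,…,Tₙ⟧` with `IsMeasure ι Σ_p S T κs γs λ ϑ C Ω Ω_p G`. WEAKER than print (all of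
`C, Ω, Ω_p, G` existential and innermost; interpolation points with `ρ` ramified dropped; the
measure on `Z(𝔠)` itself, its `Z̄_p`-integrality beyond `𝒪_{ℂ_p}` and the second critical region
`k ≤ 0` not asserted). Why it follows: push `λ̂ · 𝓛_{𝔠^m,Σ}` (`m ≫ 0`; the values (Prop. 4.9) do
not depend on `m`) forward along `Z(𝔠^m) ↠ Γ_L ↠ ℤ_pⁿ` and take its Amice transform in the
coordinates `γⱼ` ((T8)); at `χ = λρ` of the range Prop. 4.9 gives the value, with the `ρ`-free
local constants moved into `C` ((T4)). [cite: Hsieh2014mu, Prop. 4.9 (§4.8), §1 (Introduction, display) with (i)–(iii), §1.1 (ord) (unr), §3.1 (d1) (d2), §4.7 (`Eul`), §4.8]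
[cite: Katz1978, Thm. (5.3.0)] [cite: HidaTilouine1993, Thm. II] -/
def hsieh2014mu_prop49_exists_isMeasure : Prop :=
  ∀ (p : ℕ) [Fact p.Prime], 2 < p →
  ∀ (L : Type) [Field L] [NumberField L] [IsCMField L],
    ¬ (p : ℤ) ∣ NumberField.discr (maximalRealSubfield L) →
  ∀ (ι : PadicAlgCl p ≃+* ℂ) (Sp : Finset (HeightOneSpectrum (𝓞 L))), IsPAdicCMType p Sp →
  ∀ (ϑ : L), (∀ σ : L →+* ℂ, (σ ϑ).re = 0) → (∀ σ : L →+* ℂ, InSigma ι Sp σ → 0 < (σ ϑ).im) →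
  ∀ (S T D : Finset (HeightOneSpectrum (𝓞 L))),
    (∀ w ∈ S, ((p : ℕ) : 𝓞 L) ∉ w.asIdeal) →
    T ⊆ S → (∀ w ∈ T, IsCMField.complexConj L • w ≠ w ∧ IsCMField.complexConj L • w ∉ T) →
    (∀ w ∈ S, IsCMField.complexConj L • w ≠ w → (w ∈ T ∨ IsCMField.complexConj L • w ∈ T)) →
    primesOver L p ⊆ D → S ⊆ D → (∀ w ∈ S, IsCMField.complexConj L • w ∈ D) →
    (∀ w : HeightOneSpectrum (𝓞 L), w.asIdeal.ramificationIdx (𝓞 (maximalRealSubfield L)) ≠ 1 →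
      w ∈ D) →
    (∀ w ∈ D, ordAt w (2 * ϑ) = differentExponentAt w) →
  ∀ (lam : HeckeCharacter L),
    (∀ w : HeightOneSpectrum (𝓞 L), w ∉ S → ((p : ℕ) : 𝓞 L) ∉ w.asIdeal → lam.IsUnramifiedAt w) →
  ∀ (n : ℕ) (κs : Fin n → ZpExtension L p) (γs : Fin n → absoluteGaloisGroup L),
    ZpExtension.IsTopGeneratorFamily κs γs →
    ∃ (C : ℂ) (Ω : InfinitePlace L → ℂ) (Ωp : InfinitePlace L → ℂ_[p])
      (G : MvPowerSeries (Fin n) (PadicComplexInt p)),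
      C ≠ 0 ∧ (∀ w, Ω w ≠ 0) ∧ (∀ w, ‖Ωp w‖ = 1) ∧ IsMeasure ι Sp S T κs γs lam ϑ C Ω Ωp G

end Fact

/-! ### §8. API -/

section API

variable {L : Type} [Field L] [NumberField L] {p : ℕ} [Fact p.Prime] {n : ℕ}
  {ι : PadicAlgCl p ≃+* ℂ} {Sp S T : Finset (HeightOneSpectrum (𝓞 L))}
  {κs : Fin n → ZpExtension L p} {γs : Fin n → absoluteGaloisGroup L}
  {κ₁ : ZpExtension L p} {γ : absoluteGaloisGroup L}
  {lam : HeckeCharacter L} {ϑ : L} {C : ℂ} {Ω : InfinitePlace L → ℂ} {Ωp : InfinitePlace L → ℂ_[p]}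

namespace KatzCM

/-- Unfolding `IsMeasure` at one character of the typed range: the prescribed value
`∫ \widehat{λρ} d𝓛_{𝔠,Σ}` of `G` at `(r(γⱼ) − 1)ⱼ`. [cite: Hsieh2014mu, Prop. 4.9 (§4.8)] -/
theorem IsMeasure.hasValueAt {G : MvPowerSeries (Fin n) (PadicComplexInt p)}
    (hG : IsMeasure ι Sp S T κs γs lam ϑ C Ω Ωp G)
    {ρ : HeckeCharacter L} {r : FramedGaloisRep L (PadicAlgCl p) 1} {k : ℕ}
    {κ : InfinitePlace L → ℕ} (hr : IsPAdicAvatarOf ι ρ r) (hκ : FactorsThroughFamily κs r)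
    (hk : 1 ≤ k) (hinf : HasKatzType ι Sp (lam * ρ) k κ)
    (hunr : ∀ w : HeightOneSpectrum (𝓞 L), ρ.IsUnramifiedAt w)
    (hL : LFunction.HasEntireContinuation (heckeLFunction (lam * ρ))) :
    MvIntSeries.HasValueAt G (fun i ↦ avatarValueAt r (γs i) - 1)
      (((ι.symm (interpolationValue ι Sp S T lam ρ k κ ϑ C Ω (hL.continuation 0)) :
          PadicAlgCl p) : ℂ_[p]) * ∏ w, Ωp w ^ (k + 2 * κ w)) :=
  hG ρ r k κ hr hκ hk hinf hunr hL

/-- The prescribed value at a character of the typed range is unique.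
[cite: Hsieh2014mu, Prop. 4.9 (§4.8)] -/
theorem IsMeasure.eq_of_hasValueAt {G : MvPowerSeries (Fin n) (PadicComplexInt p)}
    (hG : IsMeasure ι Sp S T κs γs lam ϑ C Ω Ωp G)
    {ρ : HeckeCharacter L} {r : FramedGaloisRep L (PadicAlgCl p) 1} {k : ℕ}
    {κ : InfinitePlace L → ℕ} (hr : IsPAdicAvatarOf ι ρ r) (hκ : FactorsThroughFamily κs r)
    (hk : 1 ≤ k) (hinf : HasKatzType ι Sp (lam * ρ) k κ)
    (hunr : ∀ w : HeightOneSpectrum (𝓞 L), ρ.IsUnramifiedAt w)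
    (hL : LFunction.HasEntireContinuation (heckeLFunction (lam * ρ))) {x : ℂ_[p]}
    (hx : MvIntSeries.HasValueAt G (fun i ↦ avatarValueAt r (γs i) - 1) x) :
    x = ((ι.symm (interpolationValue ι Sp S T lam ρ k κ ϑ C Ω (hL.continuation 0)) :
          PadicAlgCl p) : ℂ_[p]) * ∏ w, Ωp w ^ (k + 2 * κ w) :=
  hx.unique (hG.hasValueAt hr hκ hk hinf hunr hL)

/-- Unfolding `IsLine` at one character of the typed range. [cite: Hsieh2014mu, Prop. 4.9 (§4.8)] -/
theorem IsLine.hasValueAt {G : PowerSeries (PadicComplexInt p)}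
    (hG : IsLine ι Sp S T κ₁ γ lam ϑ C Ω Ωp G)
    {ρ : HeckeCharacter L} {r : FramedGaloisRep L (PadicAlgCl p) 1} {k : ℕ}
    {κ : InfinitePlace L → ℕ} (hr : IsPAdicAvatarOf ι ρ r) (hκ : FactorsThroughZp κ₁ r)
    (hk : 1 ≤ k) (hinf : HasKatzType ι Sp (lam * ρ) k κ)
    (hunr : ∀ w : HeightOneSpectrum (𝓞 L), ρ.IsUnramifiedAt w)
    (hL : LFunction.HasEntireContinuation (heckeLFunction (lam * ρ))) :
    IntSeries.HasValueAt G (avatarValueAt r γ - 1)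
      (((ι.symm (interpolationValue ι Sp S T lam ρ k κ ϑ C Ω (hL.continuation 0)) :
          PadicAlgCl p) : ℂ_[p]) * ∏ w, Ωp w ^ (k + 2 * κ w)) :=
  hG ρ r k κ hr hκ hk hinf hunr hL

/-- The prescribed value on a line is unique. [cite: Hsieh2014mu, Prop. 4.9 (§4.8)] -/
theorem IsLine.eq_of_hasValueAt {G : PowerSeries (PadicComplexInt p)}
    (hG : IsLine ι Sp S T κ₁ γ lam ϑ C Ω Ωp G)
    {ρ : HeckeCharacter L} {r : FramedGaloisRep L (PadicAlgCl p) 1} {k : ℕ}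
    {κ : InfinitePlace L → ℕ} (hr : IsPAdicAvatarOf ι ρ r) (hκ : FactorsThroughZp κ₁ r)
    (hk : 1 ≤ k) (hinf : HasKatzType ι Sp (lam * ρ) k κ)
    (hunr : ∀ w : HeightOneSpectrum (𝓞 L), ρ.IsUnramifiedAt w)
    (hL : LFunction.HasEntireContinuation (heckeLFunction (lam * ρ))) {x : ℂ_[p]}
    (hx : IntSeries.HasValueAt G (avatarValueAt r γ - 1) x) :
    x = ((ι.symm (interpolationValue ι Sp S T lam ρ k κ ϑ C Ω (hL.continuation 0)) :
          PadicAlgCl p) : ℂ_[p]) * ∏ w, Ωp w ^ (k + 2 * κ w) :=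
  hx.unique (hG.hasValueAt hr hκ hk hinf hunr hL)

/-- On the typed range `χ = λρ` and `λ` have the same ramification at every place (`ρ` is
unramified everywhere), so the conductor exponents `a(χ_w) = a(λ_w)` are constant along the range —
the reason the local `ε`-factors of the range differ from `ε(0, λ_w, ψ_w)` by `ρ_w(ϖ)^{a+d}` only.
Here: `χ` is unramified at `w` iff `λ` is. [cite: TateThesis1967, §2.3] -/
theorem isUnramifiedAt_mul_iff_of_range {ρ : HeckeCharacter L} {w : HeightOneSpectrum (𝓞 L)}
    (hρ : ρ.IsUnramifiedAt w) : (lam * ρ).IsUnramifiedAt w ↔ lam.IsUnramifiedAt w := by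
  refine ⟨fun h ↦ ?_, fun h ↦ h.mul' hρ⟩
  have := h.mul' hρ.inv'
  rwa [mul_inv_cancel_right] at this

/-- The one-line existence statement a consumer on a `ℤ_p`-line uses: granted the named fact, under
its hypotheses, for a single `ℤ_p`-extension `κ₁` with topological generator `γ` there is a frame
`IsMeasure` for the one-member family `(κ₁; γ)` (`Fin 1`). [cite: Hsieh2014mu, Prop. 4.9 (§4.8)] -/
theorem exists_isMeasure_one (h : hsieh2014mu_prop49_exists_isMeasure) (hp : 2 < p) [IsCMField L]
    (hunr : ¬ (p : ℤ) ∣ NumberField.discr (maximalRealSubfield L))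
    (hSp : IsPAdicCMType p Sp) (hϑ₁ : ∀ σ : L →+* ℂ, (σ ϑ).re = 0)
    (hϑ₂ : ∀ σ : L →+* ℂ, InSigma ι Sp σ → 0 < (σ ϑ).im) {D : Finset (HeightOneSpectrum (𝓞 L))}
    (hS : ∀ w ∈ S, ((p : ℕ) : 𝓞 L) ∉ w.asIdeal) (hTS : T ⊆ S)
    (hT : ∀ w ∈ T, IsCMField.complexConj L • w ≠ w ∧ IsCMField.complexConj L • w ∉ T)
    (hST : ∀ w ∈ S, IsCMField.complexConj L • w ≠ w → (w ∈ T ∨ IsCMField.complexConj L • w ∈ T))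
    (hD₁ : primesOver L p ⊆ D) (hD₂ : S ⊆ D) (hD₃ : ∀ w ∈ S, IsCMField.complexConj L • w ∈ D)
    (hD₄ : ∀ w : HeightOneSpectrum (𝓞 L),
      w.asIdeal.ramificationIdx (𝓞 (maximalRealSubfield L)) ≠ 1 → w ∈ D)
    (hd2 : ∀ w ∈ D, ordAt w (2 * ϑ) = differentExponentAt w)
    (hlam : ∀ w : HeightOneSpectrum (𝓞 L), w ∉ S → ((p : ℕ) : 𝓞 L) ∉ w.asIdeal →
      lam.IsUnramifiedAt w)
    (hγ : κ₁.IsTopGenerator γ) :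
    ∃ (C : ℂ) (Ω : InfinitePlace L → ℂ) (Ωp : InfinitePlace L → ℂ_[p])
      (G : MvPowerSeries (Fin 1) (PadicComplexInt p)),
      C ≠ 0 ∧ (∀ w, Ω w ≠ 0) ∧ (∀ w, ‖Ωp w‖ = 1) ∧
        IsMeasure ι Sp S T (fun _ : Fin 1 ↦ κ₁) (fun _ ↦ γ) lam ϑ C Ω Ωp G :=
  h p hp L hunr ι Sp hSp ϑ hϑ₁ hϑ₂ S T D hS hTS hT hST hD₁ hD₂ hD₃ hD₄ hd2 lam hlam 1 _ _
    ((ZpExtension.isTopGeneratorFamily_one_iff κ₁ γ).mpr hγ)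

end KatzCM

end API

end Literature.NumberTheory.EllipticCurves

end
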